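import Mathlib
import Literature.Computability.AlgebraicComplexity.FSV18MonomialCompatibleBridge
import Literature.Computability.AlgebraicComplexity.FSV18Lemma55Safe
import HarnessLib

/-!
# FSV 2018 Thm. 10 (ToC Thm. 1.11) — DISCHARGED via the safe Forbes–Shpilka generator

M. A. Forbes, A. Shpilka, B. L. Volk, *Succinct hitting sets and barriers to proving lower bounds
for algebraic circuits*, ToC 14 (2018) = arXiv:1701.05328 [ForbesShpilkaVolk2018], Thm. 10
(= ToC Thm. 1.11; §7 Cor. 60). The named fact `FSV2018_thm10` (`FSV18SuccinctGenerators.lean`)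
was reduced in the tree to the named fact Lemma 55 (`FSV2018_thm10_of_lemma55`,
`FSV18MonomialCompatibleBridge.lean`, val-lit p1). Thm. 10 only asserts the EXISTENCE of a
width-`w²` roABP succinct hitting set (any individual degree of the hitting polynomials), so the
SAFE reading of Lemma 55 — the generator `fsGenCoord n w (d+1) ω β`, proved for every field as
`ForbesShpilkaVolk2018_lemma55_safe` (`FSV18Lemma55Safe.lean`, = [FS13, Thm. 3.21]) — suffices:
`P^{FS}(x_σ, α)` with parameter `d+1` is still computed by a width-`w²`, individual-degree-`1` roABP
(`isROABP_fsPoly`). The proof below is p1's proof of `FSV2018_thm10_of_lemma55` verbatim with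
`d ↦ d+1` in the generator's parameter. `FSV2018_thm10_holds : FSV2018_thm10` BY NAME; no
statement is changed; nothing here bears on `VP ≠ VNP`.
-/

noncomputable section

namespace Literature.Computability.AlgebraicComplexity

open MvPolynomial Literature.Barriers.ValiantsHypothesis FSV2018Thm10Bridge

/-- A renaming of a multilinear polynomial along a permutation is multilinear. [folklore] -/
private theorem multilinear_rename' {n : ℕ} {F : Type*} [CommSemiring F] (σ : Equiv.Perm (Fin n))
    {f : MvPolynomial (Fin n) F} (hf : ∀ m ∈ f.support, m ∈ multilinearMonomials n) :
    ∀ m ∈ (rename σ f).support, m ∈ multilinearMonomials n := by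
  classical
  intro m hm
  rw [support_rename_of_injective σ.injective, Finset.mem_image] at hm
  obtain ⟨m₀, hm₀, rfl⟩ := hm
  intro i
  rw [show i = σ (σ.symm i) by simp, Finsupp.mapDomain_apply σ.injective]
  exact hf m₀ hm₀ _

/-- **FSV Thm. 10 (ToC Thm. 1.11) — DISCHARGED:** "In the space of multilinear polynomials
`𝔽[x_1,…,x_n]^{1}_{ideg}`, the set of width-`w²` length-`n` roABPs is a succinct hitting set for
width-`w` and length-`N = 2ⁿ` roABPs with a monomial compatible ordering of the variables" (typed
form with `0 < n`, infinite field). From the SAFE Forbes–Shpilka generator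
(`ForbesShpilkaVolk2018_lemma55_safe`, parameter `d+1`) by Cor. 60's argument exactly as in
`FSV2018_thm10_of_lemma55`. [cite: ForbesShpilkaVolk2018, Thm. 10 (seq.) = ToC Thm. 1.11, p. 15; Cor. 60 (seq.; = ToC Cor. 7.6); ForbesShpilka2013, Thm. 3.21]
locator: paper:arxiv-1701.05328 p0011.txt:L20; chunk p0024.txt:L1–L6 -/
theorem FSV2018_thm10_holds : FSV2018_thm10 := by
  intro F _ _ n w d π hn hπ
  obtain ⟨σ, rfl⟩ := (isMonomialCompatible_iff π).mp hπ
  rintro D ⟨-, hD⟩ hD0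
  obtain ⟨hw, -⟩ := id hD
  obtain ⟨ω, β, hβ, hω, hord⟩ := exists_fsParams (F := F) ((2 ^ n * (d + 1) * w ^ 2) ^ 2) w
  set ψ := (permMonomials σ).symm with hψ
  have hD' : IsROABP F w d (binaryOrder n) (MvPolynomial.rename ψ D) := by
    have h := hD.rename ψ
    rwa [monomialCompatibleOrder_eq_trans, Equiv.trans_assoc, Equiv.self_trans_symm,
      Equiv.trans_refl] at h
  have hD0' : MvPolynomial.rename ψ D ≠ 0 := fun h =>
    hD0 (rename_injective _ ψ.injective (by rw [h, map_zero]))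
  obtain ⟨α, hα⟩ := (ForbesShpilkaVolk2018_lemma55_safe n w d ω β hβ hω hord).exists_eval_genOutput_ne_zero
    hD' hD0'
  refine ⟨MvPolynomial.rename σ (fsPoly n w (d + 1) ω β α), ⟨?_, σ, 1, ?_⟩, ?_⟩
  · refine multilinear_rename' σ fun m hm => ?_
    by_contra hmm
    exact (mem_support_iff.mp hm) (by rw [coeff_fsPoly, dif_neg hmm])
  · have h := (isROABP_fsPoly (n := n) hw hn (d + 1) ω β α).rename σ
    rwa [Equiv.refl_trans] at h
  · rw [← coeffVector_fsPoly, eval_rename] at hα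
    have hv : coeffVector (multilinearMonomials n)
        (MvPolynomial.rename σ (fsPoly n w (d + 1) ω β α)) =
        coeffVector (multilinearMonomials n) (fsPoly n w (d + 1) ω β α) ∘ ψ := by
      funext m
      simp only [Function.comp_apply, coeffVector_apply]
      have hm : (m : Fin n →₀ ℕ) =
          Finsupp.mapDomain σ ((ψ m : multilinearMonomials n) : Fin n →₀ ℕ) := by
        rw [← Finsupp.equivMapDomain_eq_mapDomain]
        ext i
        simp [hψ, permMonomials, Finsupp.equivMapDomain_apply]
      rw [hm, coeff_rename_mapDomain _ σ.injective]
    rw [hv]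
    exact hα

end Literature.Computability.AlgebraicComplexity
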